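import Literature.MathematicalPhysics.QuantumFieldTheory.TorusFreeTransfer
import Literature.MathematicalPhysics.QuantumFieldTheory.LatticeGaugeProofs
import HarnessLib

/-!
# Discharge: existence of the free energy density of lattice gauge theory on tori
(`Literature.MathematicalPhysics.QuantumLattice.exists_hasFreeEnergyDensity`)

Sibling proof file of `Literature/MathematicalPhysics/QuantumLattice/LatticeGaugeDLR.lean`
(trunk QLatticeAQFT, item A9; family `constructive-qft`, S17): it discharges the named fact
`exists_hasFreeEnergyDensity` (D-0014) as `exists_hasFreeEnergyDensity_holds`: for a continuous
matrix representation `ρ` of a compact second-countable group `G`, every `d` and every real `β`,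
`(L+1)^{-d} log Z_{(ℤ/(L+1)ℤ)^d, β}` converges as `L → ∞` (`Z` = Wave 0's `partitionFunction`,
the Wilson theory with periodic boundary condition). No statement of `LatticeGaugeDLR` is changed
and no definition or named fact is introduced: the weights, partition functions, boxes and
translations below are *local notations* for explicit expressions (declared at the start of
the `FreeEnergy` namespace); the auxiliary lemmas live in the sub-namespace
`Literature.MathematicalPhysics.QuantumLattice.FreeEnergy`.

## The source and the proof

The statement cites Chatterjee, J. Funct. Anal. 271 (2016), arXiv:1602.01222, whose §2
("Results") defines the free energy per site `F(Λ, g₀) = log Z(Λ, g₀) / |Λ|` and whose main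
theorem (Thm. 2.1 of the arXiv version; called Thm. 1.1 in the docstring of the statement)
determines its leading term in the joint limit `n → ∞`, `g₀ → 0` on cubes with free boundary
condition; the existence
of the limit at *fixed* coupling and with *periodic* boundary condition — the content of
`exists_hasFreeEnergyDensity` — is the standard thermodynamic-limit theorem for a bounded
finite-range interaction. The printed
argument followed is Friedli–Velenik, *Statistical Mechanics of Lattice Systems* (2017), Ch. 3,
Thm. 3.6 (proof: decompose a large box into translates of a fixed box, the interaction across
sub-boxes being a surface term; "a completely similar argument, comparing `Z^∅_{V_n}` and
`Z^{per}_{V_n}`" handles the periodic boundary condition), transcribed to the plaquette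
interaction directly on the torus:

* (`FreeEnergy.ediv_eq_of_mem_plaquetteEdges`, `FreeEnergy.disjoint_biUnion_plaquetteEdges`)
  the plaquettes `A_m = [0, m-1)^d × {planes}` (base point in `[0, m-2]^d`) have their edges in
  the cube `[0, m-1]^d`, so the translates `A_m + m v`, `v ∈ ℤ^d`, use pairwise disjoint edge
  sets;
* (`FreeEnergy.zdZ_image_shift`, `zdZ_union`, `zdZ_biUnion_translate`) the free-boundary
  partition functions `Z(A) = ∫ ∏_{p ∈ A} e^{-β (N - Re tr ρ(U_p))} dg_∞` of finite plaquette
  sets `A`, against the infinite product Haar measure `dg_∞` (`QuantumFieldTheory.zdHaar` of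
  `Sweep1`), are translation invariant and factorise over edge-disjoint sets
  (`ProductMeasureTools`: independence of disjoint blocks of coordinates), so
  `Z(⋃_{v ∈ [0,q)^d} (A_m + m v)) = Z(A_m)^{q^d}`;
* (`FreeEnergy.partitionFunction_eq_ofReal_integral`, `torusWeight_univ_le`,
  `integral_torusWeight_image`) on the torus of size `L`, `Z_L = ∫ ∏_p e^{-β(N - Re tr ρ(U_p))}`;
  discarding the plaquettes outside the image of `⋃_v (A_m + m v)` (`q = ⌊L/m⌋`, all based in
  `[0, L-2]^d`, where the projection to the torus is injective) costs a factor `e^{±K}` each,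
  `K = |β| (N + sup |Re tr ρ|)`, and the remaining integral is transferred to `ℤ^d` by the
  periodisation lemma `QuantumFieldTheory.integral_torusLift_eq_integral_zdHaar`
  (`TorusFreeTransfer`);
* (`FreeEnergy.abs_torusLogPartition_sub_le`) hence
  `|log Z_L - q^d log Z(A_m)| ≤ K · #planes · (L^d - q^d (m-1)^d)`;
* (`FreeEnergy.exists_tendsto_torusLogPartition`) dividing by `L^d` and letting `L → ∞`
  (`q/L → 1/m`), `L^{-d} log Z_L` is eventually within `K #planes (1 - ((m-1)/m)^d) + ε` of
  `m^{-d} log Z(A_m)` for every `m ≥ 1` and `ε > 0`; as the defect tends to `0` with `m`, the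
  sequence is Cauchy (`FreeEnergy.exists_tendsto_of_eventually_abs_sub_le`) and converges.

Nothing here uses `d ≥ 2`, `N ≥ 1`, a sign of `β`, or unitarity of `ρ` (only continuity, for
boundedness of `Re tr ρ` on the compact group and measurability); for `d ≤ 1` there are no
plaquettes and all quantities vanish.

## References

* S. Chatterjee, *The leading term of the Yang–Mills free energy*, J. Funct. Anal. 271 (2016),
  arXiv:1602.01222, §2 (free energy per site), Thm. 2.1. [arXiv160201222]
* S. Friedli, Y. Velenik, *Statistical Mechanics of Lattice Systems*, CUP 2017, Ch. 3, §3.2.2,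
  Thm. 3.6 and its proof. [FriedliVelenik2017]
* E. Seiler, LNP 159 (1982), Ch. 2 (thermodynamic functions of lattice gauge theories).
  [SeilerLNP1982]
-/

noncomputable section

open MeasureTheory Filter Topology Finset
open Literature.Probability.LatticeModels

namespace Literature.MathematicalPhysics.QuantumLattice

namespace FreeEnergy

variable {d : ℕ}

/-- The box of plaquettes of side `n`: base point in the half-open cube `[0, n)^d`, any plane
(local notation `𝔅⟦n⟧` for `halfOpenBox d n ×ˢ univ`). [folklore] -/
local notation3 (prettyPrint := false) "𝔅⟦" n "⟧" =>
  (halfOpenBox d n ×ˢ Finset.univ : Finset (ZdPlaquette d))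

/-- Translation of plaquettes by `v ∈ ℤ^d` (local notation `𝔰⟦v⟧` for `p ↦ (p.1 + v, p.2)`).
[folklore] -/
local notation3 (prettyPrint := false) "𝔰⟦" v "⟧" =>
  fun p : ZdPlaquette d => (p.1 + v, p.2)

/-- The torus plaquette below a plaquette of `ℤ^d` (local notation `𝔭⟦L⟧` for
`p ↦ (Torus.proj L p.1, p.2)`). [folklore] -/
local notation3 (prettyPrint := false) "𝔭⟦" L "⟧" =>
  fun p : ZdPlaquette d => ((Torus.proj L p.1, p.2) : QuantumFieldTheory.Plaquette d L)

/-! ### Geometry: boxes of plaquettes and their translates -/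

/-- Membership in the box of plaquettes: the base point lies in `[0, n)^d`. [folklore] -/
theorem mem_boxPlaqs {n : ℕ} {p : ZdPlaquette d} :
    p ∈ 𝔅⟦n⟧ ↔ ∀ k, 0 ≤ p.1 k ∧ p.1 k < n := by
  simp [mem_halfOpenBox]

/-- `|[0, n)^d × planes| = n^d · #planes`. [folklore] -/
theorem card_boxPlaqs (n : ℕ) :
    #𝔅⟦n⟧ = n ^ d * Fintype.card {q : Fin d × Fin d // q.1 < q.2} := by
  rw [card_product, card_halfOpenBox, card_univ]

/-- Translation of plaquettes by `v ∈ ℤ^d` is injective. [folklore] -/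
theorem shift_injective (v : Site d) : Function.Injective 𝔰⟦v⟧ := by
  intro p q h
  simp only [Prod.mk.injEq, add_left_inj] at h
  exact Prod.ext h.1 h.2

/-- Base points of translated box plaquettes. [folklore] -/
theorem fst_bounds_of_mem_image_shift {n : ℕ} {w : Site d} {p : ZdPlaquette d}
    (hp : p ∈ 𝔅⟦n⟧.image 𝔰⟦w⟧) (k : Fin d) :
    w k ≤ p.1 k ∧ p.1 k < w k + n := by
  obtain ⟨p', hp', rfl⟩ := mem_image.1 hp
  obtain ⟨h0, h1⟩ := mem_boxPlaqs.1 hp' k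
  simp only [Pi.add_apply]
  constructor <;> linarith

/-- The edges of the plaquettes of the box of side `n + 1 ≤ m` translated by `m v` have base
points `y` with `⌊y_k / m⌋ = v_k`. [folklore] -/
theorem ediv_eq_of_mem_plaquetteEdges {n m : ℕ} (hm : n + 1 ≤ m) {v : Site d}
    {p : ZdPlaquette d} (hp : p ∈ 𝔅⟦n⟧.image 𝔰⟦(m : ℤ) • v⟧)
    {e : ZdEdge d} (he : e ∈ plaquetteEdges p) (k : Fin d) : e.1 k / m = v k := by
  obtain ⟨hw1, hw2⟩ := fst_bounds_of_mem_image_shift hp k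
  obtain ⟨he1, he2⟩ := QuantumFieldTheory.level_bounds_of_mem_plaquetteEdges he k
  simp only [Pi.smul_apply, smul_eq_mul] at hw1 hw2
  have hm0 : (0 : ℤ) < m := by exact_mod_cast Nat.lt_of_lt_of_le (Nat.succ_pos n) hm
  have hmn : (n : ℤ) + 1 ≤ m := by exact_mod_cast hm
  set a : ℤ := e.1 k - m * v k with ha
  have ha0 : 0 ≤ a := by rw [ha]; linarith
  have ham : a < m := by rw [ha]; linarith
  have : e.1 k = a + v k * m := by rw [ha]; ring
  rw [this, Int.add_mul_ediv_right _ _ hm0.ne', Int.ediv_eq_zero_of_lt ha0 ham, zero_add]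

/-- Distinct translates (by multiples of `m ≥ n + 1`) of the box plaquettes use disjoint sets
of edges. [folklore] -/
theorem disjoint_biUnion_plaquetteEdges {n m : ℕ} (hm : n + 1 ≤ m) {v w : Site d} (hvw : v ≠ w) :
    Disjoint ((𝔅⟦n⟧.image 𝔰⟦(m : ℤ) • v⟧).biUnion plaquetteEdges)
      ((𝔅⟦n⟧.image 𝔰⟦(m : ℤ) • w⟧).biUnion plaquetteEdges) := by
  rw [Finset.disjoint_left]
  intro e hev hew
  obtain ⟨p, hp, hep⟩ := mem_biUnion.1 hev
  obtain ⟨q, hq, heq⟩ := mem_biUnion.1 hew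
  exact hvw (funext fun k => (ediv_eq_of_mem_plaquetteEdges hm hp hep k).symm.trans
    (ediv_eq_of_mem_plaquetteEdges hm hq heq k))

/-- Distinct translates of the box plaquettes are disjoint. [folklore] -/
theorem disjoint_image_shift {n m : ℕ} (hm : n + 1 ≤ m) {v w : Site d} (hvw : v ≠ w) :
    Disjoint (𝔅⟦n⟧.image 𝔰⟦(m : ℤ) • v⟧) (𝔅⟦n⟧.image 𝔰⟦(m : ℤ) • w⟧) := by
  rw [Finset.disjoint_left]
  intro p hpv hpw
  have hev : (p.1, p.2.1.1) ∈ plaquetteEdges p := by simp [plaquetteEdges]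
  exact hvw (funext fun k => (ediv_eq_of_mem_plaquetteEdges hm hpv hev k).symm.trans
    (ediv_eq_of_mem_plaquetteEdges hm hpw hev k))

/-! ### The torus projection on the fundamental cube -/

/-- `Torus.proj L` is injective on the half-open cube `[0, L)^d`. [folklore] -/
theorem torusProj_injOn_halfOpen {L : ℕ} {x y : Site d} (hx : ∀ k, 0 ≤ x k ∧ x k < L)
    (hy : ∀ k, 0 ≤ y k ∧ y k < L) (h : Torus.proj L x = Torus.proj L y) : x = y := by
  funext k
  have hk : ((x k : ℤ) : ZMod L) = ((y k : ℤ) : ZMod L) := by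
    have := congrFun h k
    simpa [Torus.proj_apply] using this
  rw [ZMod.intCast_eq_intCast_iff_dvd_sub] at hk
  obtain ⟨hx1, hx2⟩ := hx k
  obtain ⟨hy1, hy2⟩ := hy k
  have hlt : |y k - x k| < (L : ℤ) := by
    rw [abs_lt]; constructor <;> linarith
  have h0 := Int.eq_zero_of_abs_lt_dvd hk hlt
  linarith

/-- The projection `p ↦ (proj p.1, p.2)` to torus plaquettes is injective on plaquettes based in
`[0, L-2]^d`. [folklore] -/
theorem toTorus_injOn {L : ℕ} {I' : Finset (ZdPlaquette d)}
    (hI' : ∀ p ∈ I', ∀ k, 0 ≤ p.1 k ∧ p.1 k + 2 ≤ L) :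
    ∀ p ∈ I', ∀ q ∈ I', 𝔭⟦L⟧ p = 𝔭⟦L⟧ q → p = q := by
  intro p hp q hq hpq
  simp only [Prod.mk.injEq] at hpq
  refine Prod.ext (torusProj_injOn_halfOpen (L := L) (fun k => ?_) (fun k => ?_) hpq.1) hpq.2
  · obtain ⟨h0, h2⟩ := hI' p hp k; exact ⟨h0, by linarith⟩
  · obtain ⟨h0, h2⟩ := hI' q hq k; exact ⟨h0, by linarith⟩

/-- `torusEdge L` is injective on the edges of plaquettes based in `[0, L-2]^d`. [folklore] -/
theorem injOn_torusEdge_biUnion {L : ℕ} {I' : Finset (ZdPlaquette d)}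
    (hI' : ∀ p ∈ I', ∀ k, 0 ≤ p.1 k ∧ p.1 k + 2 ≤ L) :
    Set.InjOn (torusEdge (d := d) L) ↑(I'.biUnion plaquetteEdges) := by
  intro e he e' he' hee'
  simp only [torusEdge, Prod.mk.injEq] at hee'
  obtain ⟨p, hp, hep⟩ := mem_biUnion.1 (mem_coe.1 he)
  obtain ⟨p', hp', hep'⟩ := mem_biUnion.1 (mem_coe.1 he')
  refine Prod.ext (torusProj_injOn_halfOpen (L := L) (fun k => ?_) (fun k => ?_) hee'.1) hee'.2
  · obtain ⟨h0, h2⟩ := hI' p hp k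
    obtain ⟨h3, h4⟩ := QuantumFieldTheory.level_bounds_of_mem_plaquetteEdges hep k
    exact ⟨by linarith, by linarith⟩
  · obtain ⟨h0, h2⟩ := hI' p' hp' k
    obtain ⟨h3, h4⟩ := QuantumFieldTheory.level_bounds_of_mem_plaquetteEdges hep' k
    exact ⟨by linarith, by linarith⟩

/-- The number of torus plaquettes below a set of plaquettes based in `[0, L-2]^d`. [folklore] -/
theorem card_image_toTorus {L : ℕ} {I' : Finset (ZdPlaquette d)}
    (hI' : ∀ p ∈ I', ∀ k, 0 ≤ p.1 k ∧ p.1 k + 2 ≤ L) :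
    #(I'.image 𝔭⟦L⟧) = #I' :=
  card_image_of_injOn fun p hp q hq hpq => toTorus_injOn hI' p (mem_coe.1 hp) q (mem_coe.1 hq) hpq

/-! ### Weights and partition functions (local notations)

From here on `ρ : G →* Matrix (Fin N) (Fin N) ℂ` is fixed. The Boltzmann weight of one
plaquette `p` of `ℤ^d` in the configuration `U` is `𝔴⟦β, p, U⟧ = exp(-β (N - Re tr ρ(U_p)))`;
the free-boundary partition function of a finite set `A` of plaquettes (no other plaquette
enters) is `ℨ⟦β, A⟧ = ∫ ∏_{p ∈ A} 𝔴⟦β, p, U⟧ dg_∞(U)` against the infinite product Haar measure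
`QuantumFieldTheory.zdHaar`; on the discrete torus the weight of a plaquette is
`𝔱⟦β, p, U⟧ = exp(-β · plaquetteCost ρ U p)` (the same formula). -/

variable {N : ℕ} {G : Type*} [Group G] [TopologicalSpace G] [IsTopologicalGroup G]
  [CompactSpace G] [MeasurableSpace G] [BorelSpace G] (ρ : G →* Matrix (Fin N) (Fin N) ℂ)

/-- The Boltzmann weight `exp(-β (N - Re tr ρ(U_p)))` of one plaquette of `ℤ^d` (local notation).
[folklore] -/
local notation3 (prettyPrint := false) "𝔴⟦" β ", " p ", " U "⟧" =>
  Real.exp (-β * ((N : ℝ) - plaquetteObs ρ (Prod.fst p) (Prod.snd p).1.1 (Prod.snd p).1.2 U))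

/-- The free-boundary partition function `Z(A) = ∫ ∏_{p ∈ A} exp(-β (N - Re tr ρ(U_p))) dg_∞` of a
finite set of plaquettes of `ℤ^d` (local notation). [folklore] -/
local notation3 (prettyPrint := false) "ℨ⟦" β ", " A "⟧" =>
  ∫ U, ∏ p ∈ A, 𝔴⟦β, p, U⟧ ∂QuantumFieldTheory.zdHaar d G

/-- The Boltzmann weight `exp(-β (N - Re tr ρ(U_p)))` of one plaquette of the discrete torus
(local notation). [folklore] -/
local notation3 (prettyPrint := false) "𝔱⟦" β ", " p ", " U "⟧" =>
  Real.exp (-β * QuantumFieldTheory.plaquetteCost ρ U p)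

/-! ### The free-boundary plaquette weights on `ℤ^d` and their product-Haar integrals -/

omit [TopologicalSpace G] [IsTopologicalGroup G] [CompactSpace G] [MeasurableSpace G]
  [BorelSpace G] in
/-- The exponent of a plaquette weight is bounded by `|β| (N + M)` when `|Re tr ρ| ≤ M`.
[folklore] -/
theorem abs_mul_cost_le {M : ℝ} (hM : ∀ g, |(ρ g).trace.re| ≤ M) (β : ℝ) (g : G) :
    |(-β) * ((N : ℝ) - (ρ g).trace.re)| ≤ |β| * (N + M) := by
  rw [abs_mul, abs_neg]
  refine mul_le_mul_of_nonneg_left ?_ (abs_nonneg _)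
  calc |(N : ℝ) - (ρ g).trace.re| ≤ |(N : ℝ)| + |(ρ g).trace.re| := abs_sub _ _
    _ ≤ N + M := by rw [Nat.abs_cast]; exact add_le_add le_rfl (hM g)

omit [TopologicalSpace G] [IsTopologicalGroup G] [CompactSpace G] [MeasurableSpace G]
  [BorelSpace G] in
/-- `∏_{p ∈ A} w_p ≤ exp(|β| (N + M))^{|A|}`. [folklore] -/
theorem boxWeight_le {M : ℝ} (hM : ∀ g, |(ρ g).trace.re| ≤ M) (β : ℝ)
    (A : Finset (ZdPlaquette d)) (U : LGConfig d G) :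
    ∏ p ∈ A, 𝔴⟦β, p, U⟧ ≤ Real.exp (|β| * (N + M)) ^ #A := by
  rw [← prod_const]
  exact prod_le_prod (fun p _ => (Real.exp_pos _).le) fun p _ =>
    Real.exp_le_exp.2 (abs_le.1 (abs_mul_cost_le ρ hM β _)).2

omit [TopologicalSpace G] [IsTopologicalGroup G] [CompactSpace G] [MeasurableSpace G]
  [BorelSpace G] in
/-- `exp(-|β| (N + M))^{|A|} ≤ ∏_{p ∈ A} w_p`. [folklore] -/
theorem pow_le_boxWeight {M : ℝ} (hM : ∀ g, |(ρ g).trace.re| ≤ M) (β : ℝ)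
    (A : Finset (ZdPlaquette d)) (U : LGConfig d G) :
    Real.exp (-(|β| * (N + M))) ^ #A ≤ ∏ p ∈ A, 𝔴⟦β, p, U⟧ := by
  rw [← prod_const]
  exact prod_le_prod (fun p _ => (Real.exp_pos _).le) fun p _ =>
    Real.exp_le_exp.2 (abs_le.1 (abs_mul_cost_le ρ hM β _)).1

omit [TopologicalSpace G] [IsTopologicalGroup G] [CompactSpace G] [MeasurableSpace G]
  [BorelSpace G] in
/-- The box weight depends only on the edges of its plaquettes. [folklore] -/
theorem dependsOn_boxWeight (β : ℝ) (A : Finset (ZdPlaquette d)) :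
    DependsOn (fun U : LGConfig d G => ∏ p ∈ A, 𝔴⟦β, p, U⟧) ↑(A.biUnion plaquetteEdges) :=
  QuantumFieldTheory.AreaLaw.dependsOn_finset_prod A plaquetteEdges _ fun p _ U V h => by
    rw [isCylinder_plaquetteObs ρ p h]

omit [CompactSpace G] [MeasurableSpace G] [BorelSpace G] in
/-- The box weight is continuous for continuous `ρ`. [folklore] -/
theorem continuous_boxWeight (hρ : Continuous ρ) (β : ℝ) (A : Finset (ZdPlaquette d)) :
    Continuous fun U : LGConfig d G => ∏ p ∈ A, 𝔴⟦β, p, U⟧ := by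
  refine continuous_finsetProd _ fun p _ => ?_
  unfold plaquetteObs
  have h1 : Continuous fun U : LGConfig d G => plaquetteHolonomyZd U p.1 p.2.1.1 p.2.1.2 := by
    unfold plaquetteHolonomyZd; fun_prop
  have h2 : Continuous fun U : LGConfig d G =>
      (ρ (plaquetteHolonomyZd U p.1 p.2.1.1 p.2.1.2)).trace.re :=
    Complex.continuous_re.comp (hρ.comp h1).matrix_trace
  exact Real.continuous_exp.comp (continuous_const.mul (continuous_const.sub h2))

omit [TopologicalSpace G] [IsTopologicalGroup G] [CompactSpace G] [MeasurableSpace G]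
  [BorelSpace G] in
/-- Translating the configuration translates the plaquettes:
`W_A(U ∘ θ_v) = W_{A + v}(U)`. [folklore] -/
theorem boxWeight_comp_edgeShift (β : ℝ) (v : Site d) (A : Finset (ZdPlaquette d))
    (U : LGConfig d G) :
    ∏ p ∈ A, 𝔴⟦β, p, (fun e => U (edgeShift v e))⟧ = ∏ p ∈ A.image 𝔰⟦v⟧, 𝔴⟦β, p, U⟧ := by
  rw [prod_image fun p _ q _ h => shift_injective v h]
  refine prod_congr rfl fun p _ => ?_
  simp only [plaquetteObs, plaquetteHolonomyZd, edgeShift_apply, add_right_comm _ _ v]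

variable [SecondCountableTopology G]

/-- The box weight is integrable for `dg_∞`. [folklore] -/
theorem integrable_boxWeight (hρ : Continuous ρ) (β : ℝ) (A : Finset (ZdPlaquette d)) :
    Integrable (fun U : LGConfig d G => ∏ p ∈ A, 𝔴⟦β, p, U⟧) (QuantumFieldTheory.zdHaar d G) :=
  QuantumFieldTheory.AreaLaw.integrable_zdHaar_of_continuous (continuous_boxWeight ρ hρ β A)

/-- `Z(A) ≤ exp(|β| (N + M))^{|A|}`. [folklore] -/
theorem zdZ_le (hρ : Continuous ρ) {M : ℝ} (hM : ∀ g, |(ρ g).trace.re| ≤ M) (β : ℝ)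
    (A : Finset (ZdPlaquette d)) : ℨ⟦β, A⟧ ≤ Real.exp (|β| * (N + M)) ^ #A := by
  calc ℨ⟦β, A⟧ ≤ ∫ _U, Real.exp (|β| * (N + M)) ^ #A ∂QuantumFieldTheory.zdHaar d G :=
        integral_mono (integrable_boxWeight ρ hρ β A) (integrable_const _)
          fun U => boxWeight_le ρ hM β A U
    _ = Real.exp (|β| * (N + M)) ^ #A := by simp

/-- `exp(-|β| (N + M))^{|A|} ≤ Z(A)`. [folklore] -/
theorem pow_le_zdZ (hρ : Continuous ρ) {M : ℝ} (hM : ∀ g, |(ρ g).trace.re| ≤ M) (β : ℝ)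
    (A : Finset (ZdPlaquette d)) : Real.exp (-(|β| * (N + M))) ^ #A ≤ ℨ⟦β, A⟧ := by
  calc Real.exp (-(|β| * (N + M))) ^ #A
      = ∫ _U, Real.exp (-(|β| * (N + M))) ^ #A ∂QuantumFieldTheory.zdHaar d G := by simp
    _ ≤ ℨ⟦β, A⟧ :=
        integral_mono (integrable_const _) (integrable_boxWeight ρ hρ β A)
          fun U => pow_le_boxWeight ρ hM β A U

/-- The free-boundary partition functions are positive. [folklore] -/
theorem zdZ_pos (hρ : Continuous ρ) (β : ℝ) (A : Finset (ZdPlaquette d)) : 0 < ℨ⟦β, A⟧ := by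
  obtain ⟨M, -, hM⟩ := QuantumFieldTheory.exists_bound_trace_re_nonneg ρ hρ
  exact lt_of_lt_of_le (pow_pos (Real.exp_pos _) _) (pow_le_zdZ ρ hρ hM β A)

/-- **Translation invariance** of the free-boundary partition functions: `Z(A + v) = Z(A)`
(`dg_∞` is invariant under the edge shift). [folklore] -/
theorem zdZ_image_shift (hρ : Continuous ρ) (β : ℝ) (v : Site d) (A : Finset (ZdPlaquette d)) :
    ℨ⟦β, A.image 𝔰⟦v⟧⟧ = ℨ⟦β, A⟧ := by
  calc ℨ⟦β, A.image 𝔰⟦v⟧⟧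
      = ∫ U, ∏ p ∈ A, 𝔴⟦β, p, (fun e => U (edgeShift v e))⟧ ∂QuantumFieldTheory.zdHaar d G := by
        simp_rw [boxWeight_comp_edgeShift]
    _ = ℨ⟦β, A⟧ :=
        integral_comp_reindex_infinitePi (QuantumFieldTheory.haarProbability G) (edgeShift v)
          (integrable_boxWeight ρ hρ β A).aestronglyMeasurable

/-- **Factorisation** of the free-boundary partition functions over edge-disjoint sets of
plaquettes: `Z(A ∪ B) = Z(A) Z(B)`. [folklore] -/
theorem zdZ_union (hρ : Continuous ρ) (β : ℝ) {A B : Finset (ZdPlaquette d)} (hAB : Disjoint A B)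
    (hE : Disjoint (A.biUnion plaquetteEdges) (B.biUnion plaquetteEdges)) :
    ℨ⟦β, (A ∪ B)⟧ = ℨ⟦β, A⟧ * ℨ⟦β, B⟧ := by
  simp_rw [prod_union hAB]
  exact QuantumFieldTheory.AreaLaw.integral_zdHaar_mul_eq_of_dependsOn hE
    (dependsOn_boxWeight ρ β A) (dependsOn_boxWeight ρ β B)
    (continuous_boxWeight ρ hρ β A).measurable (continuous_boxWeight ρ hρ β B).measurable

/-- The partition function of a disjoint union of translates (by multiples of `m ≥ n + 1`) of
the box of side `n` is the `|V|`-th power of the box partition function. [folklore] -/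
theorem zdZ_biUnion_translate (hρ : Continuous ρ) (β : ℝ) {n m : ℕ} (hm : n + 1 ≤ m)
    (V : Finset (Site d)) :
    ℨ⟦β, (V.biUnion fun v => 𝔅⟦n⟧.image 𝔰⟦(m : ℤ) • v⟧)⟧ = ℨ⟦β, 𝔅⟦n⟧⟧ ^ #V := by
  classical
  induction V using Finset.induction_on with
  | empty => simp
  | insert v V hv ih =>
    rw [biUnion_insert, zdZ_union ρ hρ β, ih, zdZ_image_shift ρ hρ, card_insert_of_notMem hv,
      pow_succ']
    · rw [Finset.disjoint_biUnion_right]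
      intro w hw
      exact disjoint_image_shift hm fun h => hv (h ▸ hw)
    · rw [Finset.biUnion_biUnion, Finset.disjoint_biUnion_right]
      intro w hw
      exact disjoint_biUnion_plaquetteEdges hm fun h => hv (h ▸ hw)

/-! ### The torus side: Boltzmann weights of sets of torus plaquettes -/

omit [TopologicalSpace G] [IsTopologicalGroup G] [CompactSpace G] [MeasurableSpace G]
  [BorelSpace G] [SecondCountableTopology G] in
/-- The Wilson weight of the torus is the weight of all its plaquettes:
`exp(-β S(U)) = ∏_p exp(-β (N - Re tr ρ(U_p)))`. [folklore] -/
theorem exp_neg_mul_wilsonAction {L : ℕ} [NeZero L] (β : ℝ)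
    (U : QuantumFieldTheory.GaugeConfig d L G) :
    Real.exp (-β * QuantumFieldTheory.wilsonAction ρ U) = ∏ p ∈ univ, 𝔱⟦β, p, U⟧ := by
  unfold QuantumFieldTheory.wilsonAction QuantumFieldTheory.plaquetteCost
  rw [Finset.mul_sum, Real.exp_sum]

omit [TopologicalSpace G] [IsTopologicalGroup G] [CompactSpace G] [MeasurableSpace G]
  [BorelSpace G] [SecondCountableTopology G] in
/-- Dropping the plaquettes outside `I` costs at most a factor `exp(|β| (N + M))` per plaquette
(upper bound). [folklore] -/
theorem torusWeight_univ_le {M : ℝ} (hM : ∀ g, |(ρ g).trace.re| ≤ M) {L : ℕ} [NeZero L] (β : ℝ)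
    (I : Finset (QuantumFieldTheory.Plaquette d L)) (U : QuantumFieldTheory.GaugeConfig d L G) :
    ∏ p ∈ univ, 𝔱⟦β, p, U⟧ ≤ Real.exp (|β| * (N + M)) ^ #Iᶜ * ∏ p ∈ I, 𝔱⟦β, p, U⟧ := by
  classical
  rw [← prod_mul_prod_compl I, mul_comm]
  refine mul_le_mul_of_nonneg_right ?_ (prod_nonneg fun p _ => (Real.exp_pos _).le)
  rw [← prod_const]
  exact prod_le_prod (fun p _ => (Real.exp_pos _).le) fun p _ =>
    Real.exp_le_exp.2 (abs_le.1 (abs_mul_cost_le ρ hM β _)).2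

omit [TopologicalSpace G] [IsTopologicalGroup G] [CompactSpace G] [MeasurableSpace G]
  [BorelSpace G] [SecondCountableTopology G] in
/-- Dropping the plaquettes outside `I` costs at most a factor `exp(|β| (N + M))` per plaquette
(lower bound). [folklore] -/
theorem mul_torusWeight_le_univ {M : ℝ} (hM : ∀ g, |(ρ g).trace.re| ≤ M) {L : ℕ} [NeZero L]
    (β : ℝ) (I : Finset (QuantumFieldTheory.Plaquette d L))
    (U : QuantumFieldTheory.GaugeConfig d L G) :
    Real.exp (-(|β| * (N + M))) ^ #Iᶜ * ∏ p ∈ I, 𝔱⟦β, p, U⟧ ≤ ∏ p ∈ univ, 𝔱⟦β, p, U⟧ := by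
  classical
  rw [← prod_mul_prod_compl I, mul_comm]
  refine mul_le_mul_of_nonneg_left ?_ (prod_nonneg fun p _ => (Real.exp_pos _).le)
  rw [← prod_const]
  exact prod_le_prod (fun p _ => (Real.exp_pos _).le) fun p _ =>
    Real.exp_le_exp.2 (abs_le.1 (abs_mul_cost_le ρ hM β _)).1

omit [TopologicalSpace G] [IsTopologicalGroup G] [CompactSpace G] [MeasurableSpace G]
  [BorelSpace G] [SecondCountableTopology G] in
/-- Plaquette holonomies of the periodic lift are the torus holonomies below
(`QuantumFieldTheory.plaquette_torusLift`, restated for `plaquetteHolonomyZd`). [folklore] -/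
theorem plaquetteHolonomyZd_torusLift (L : ℕ) (U : QuantumFieldTheory.GaugeConfig d L G)
    (x : Site d) (i j : Fin d) :
    plaquetteHolonomyZd (torusLift L U) x i j =
      QuantumFieldTheory.plaquetteHolonomy U (Torus.proj L x) i j :=
  QuantumFieldTheory.plaquette_torusLift L U x i j

omit [TopologicalSpace G] [IsTopologicalGroup G] [CompactSpace G] [MeasurableSpace G]
  [BorelSpace G] [SecondCountableTopology G] in
/-- The torus weight of the image of a set `I'` of plaquettes of `ℤ^d` based in `[0, L-2]^d` is the
`ℤ^d` box weight of `I'` read on the periodic lift. [folklore] -/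
theorem torusWeight_image_eq {L : ℕ} [NeZero L] (β : ℝ) {I' : Finset (ZdPlaquette d)}
    (hI' : ∀ p ∈ I', ∀ k, 0 ≤ p.1 k ∧ p.1 k + 2 ≤ L) (U : QuantumFieldTheory.GaugeConfig d L G) :
    ∏ p ∈ I'.image 𝔭⟦L⟧, 𝔱⟦β, p, U⟧ = ∏ p ∈ I', 𝔴⟦β, p, (torusLift L U)⟧ := by
  classical
  rw [prod_image (toTorus_injOn hI')]
  refine prod_congr rfl fun p _ => ?_
  simp only [plaquetteObs, QuantumFieldTheory.plaquetteCost]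
  rw [plaquetteHolonomyZd_torusLift]

omit [CompactSpace G] [MeasurableSpace G] [BorelSpace G] [SecondCountableTopology G] in
/-- The torus weights are continuous for continuous `ρ`. [folklore] -/
theorem continuous_torusWeight (hρ : Continuous ρ) {L : ℕ} [NeZero L] (β : ℝ)
    (I : Finset (QuantumFieldTheory.Plaquette d L)) :
    Continuous fun U : QuantumFieldTheory.GaugeConfig d L G => ∏ p ∈ I, 𝔱⟦β, p, U⟧ := by
  unfold QuantumFieldTheory.plaquetteCost
  refine continuous_finsetProd _ fun p _ => ?_
  have h1 : Continuous fun U : QuantumFieldTheory.GaugeConfig d L G =>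
      QuantumFieldTheory.plaquetteHolonomy U p.1 p.2.1.1 p.2.1.2 := by
    unfold QuantumFieldTheory.plaquetteHolonomy; fun_prop
  have h2 : Continuous fun U : QuantumFieldTheory.GaugeConfig d L G =>
      (ρ (QuantumFieldTheory.plaquetteHolonomy U p.1 p.2.1.1 p.2.1.2)).trace.re :=
    Complex.continuous_re.comp (hρ.comp h1).matrix_trace
  exact Real.continuous_exp.comp (continuous_const.mul (continuous_const.sub h2))

/-- The torus weights are integrable for the product Haar measure. [folklore] -/
theorem integrable_torusWeight (hρ : Continuous ρ) {L : ℕ} [NeZero L] (β : ℝ)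
    (I : Finset (QuantumFieldTheory.Plaquette d L)) :
    Integrable (fun U : QuantumFieldTheory.GaugeConfig d L G => ∏ p ∈ I, 𝔱⟦β, p, U⟧)
      (Measure.pi fun _ : QuantumFieldTheory.Edge d L => QuantumFieldTheory.haarProbability G) :=
  (continuous_torusWeight ρ hρ β I).integrable_of_hasCompactSupport
    (HasCompactSupport.of_compactSpace _)

/-- **The torus partition function as an integral of the full torus weight**:
`Z_{Λ_L, β} = ∫ ∏_p exp(-β (N - Re tr ρ(U_p))) dHaar^{⊗ edges}`. [folklore] -/
theorem partitionFunction_eq_ofReal_integral (hρ : Continuous ρ) {L : ℕ} [NeZero L] (β : ℝ) :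
    QuantumFieldTheory.partitionFunction (d := d) (L := L) ρ β =
      ENNReal.ofReal (∫ U, ∏ p ∈ univ, 𝔱⟦β, p, U⟧
        ∂Measure.pi fun _ : QuantumFieldTheory.Edge d L =>
          QuantumFieldTheory.haarProbability G) := by
  unfold QuantumFieldTheory.partitionFunction QuantumFieldTheory.wilsonWeight
  rw [withDensity_apply _ MeasurableSet.univ, Measure.restrict_univ]
  simp_rw [exp_neg_mul_wilsonAction]
  rw [ofReal_integral_eq_lintegral_ofReal (integrable_torusWeight ρ hρ β _)
    (ae_of_all _ fun U => prod_nonneg fun _ _ => (Real.exp_pos _).le)]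

/-- **Transfer to `ℤ^d`.** The product-Haar integral of the torus weight of the image of a set
`I'` of plaquettes of `ℤ^d` based in `[0, L-2]^d` is the free-boundary partition function
`Z(I')` (periodisation, `QuantumFieldTheory.integral_torusLift_eq_integral_zdHaar`). [folklore] -/
theorem integral_torusWeight_image (hρ : Continuous ρ) {L : ℕ} [NeZero L] (β : ℝ)
    {I' : Finset (ZdPlaquette d)} (hI' : ∀ p ∈ I', ∀ k, 0 ≤ p.1 k ∧ p.1 k + 2 ≤ L) :
    ∫ U, ∏ p ∈ I'.image 𝔭⟦L⟧, 𝔱⟦β, p, U⟧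
        ∂(Measure.pi fun _ : QuantumFieldTheory.Edge d L => QuantumFieldTheory.haarProbability G) =
      ℨ⟦β, I'⟧ := by
  simp_rw [torusWeight_image_eq ρ β hI']
  exact QuantumFieldTheory.integral_torusLift_eq_integral_zdHaar (injOn_torusEdge_biUnion hI')
    (continuous_boxWeight ρ hρ β I').measurable (dependsOn_boxWeight ρ β I')

/-! ### The sub-box estimate for the torus free energy -/

/-- **The sub-box estimate** (Friedli–Velenik 2017, proof of Thm. 3.6, adapted to the plaquette
interaction and to the periodic boundary condition). Tile the torus `(ℤ/Lℤ)^d` by the `q^d`,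
`q = ⌊L/m⌋`, translates `B + m v` (`v ∈ [0, q)^d`) of the cube `B = [0, m-1]^d`; keep only the
plaquettes based in the `[0, m-2]^d`-parts `A_m + m v` (whose edges stay inside their cube), at a
cost `exp(±|β| (N + sup|Re tr ρ|))` per discarded plaquette; the remaining weight factorises
over the cubes (product Haar measure) and each factor is the free-boundary partition function
`Z(A_m)` of one cube (translation invariance and periodisation). Hence
`|log Z_{Λ_L} - q^d log Z(A_m)| ≤ |β| (N + M) · #planes · (L^d - q^d (m-1)^d)`. [cite: FriedliVelenik2017, Ch. 3 §3.2.2, proof of Thm. 3.6 (decomposition into translates of a fixed box; periodic boundary condition)] -/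
theorem abs_torusLogPartition_sub_le (hρ : Continuous ρ) {M : ℝ} (hM : ∀ g, |(ρ g).trace.re| ≤ M)
    (β : ℝ) (L m : ℕ) [NeZero L] (hm : 1 ≤ m) :
    |torusLogPartition d ρ β L - ((L / m) ^ d : ℕ) * Real.log ℨ⟦β, 𝔅⟦m - 1⟧⟧| ≤
      |β| * (N + M) * (Fintype.card {q : Fin d × Fin d // q.1 < q.2} *
        ((L : ℝ) ^ d - ((L / m) ^ d : ℕ) * ((m - 1 : ℕ) : ℝ) ^ d)) := by
  classical
  set q : ℕ := L / m with hq
  set D : ℕ := Fintype.card {q : Fin d × Fin d // q.1 < q.2} with hD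
  set K : ℝ := |β| * (N + M) with hK
  set A : Finset (ZdPlaquette d) := 𝔅⟦m - 1⟧ with hA
  set V : Finset (Site d) := halfOpenBox d q with hV
  set I' : Finset (ZdPlaquette d) := V.biUnion fun v => A.image 𝔰⟦(m : ℤ) • v⟧ with hI'
  set I : Finset (QuantumFieldTheory.Plaquette d L) := I'.image 𝔭⟦L⟧ with hI
  set P : Measure (QuantumFieldTheory.GaugeConfig d L G) :=
    Measure.pi fun _ => QuantumFieldTheory.haarProbability G with hP
  have hm' : m - 1 + 1 ≤ m := by omega
  -- the plaquettes kept are based in `[0, L - 2]^d`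
  have hI'b : ∀ p ∈ I', ∀ k, 0 ≤ p.1 k ∧ p.1 k + 2 ≤ L := by
    intro p hp k
    obtain ⟨v, hv, hpv⟩ := mem_biUnion.1 hp
    obtain ⟨hv0, hvq⟩ := mem_halfOpenBox.1 hv k
    obtain ⟨h1, h2⟩ := fst_bounds_of_mem_image_shift hpv k
    simp only [Pi.smul_apply, smul_eq_mul] at h1 h2
    have hm1 : ((m - 1 : ℕ) : ℤ) = m - 1 := by push_cast [Nat.cast_sub hm]; ring
    have hqm : (m : ℤ) * q ≤ L := by exact_mod_cast Nat.mul_div_le L m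
    have hmv : 0 ≤ (m : ℤ) * v k := mul_nonneg (by positivity) hv0
    have hmv' : (m : ℤ) * (v k + 1) ≤ m * q :=
      mul_le_mul_of_nonneg_left (by linarith) (by positivity)
    rw [hm1] at h2
    constructor
    · linarith
    · nlinarith
  -- cardinalities
  have hcardI : #I = q ^ d * #A := by
    rw [hI, card_image_toTorus hI'b, hI', card_biUnion]
    · simp_rw [card_image_of_injective _ (shift_injective _)]
      rw [sum_const, hV, card_halfOpenBox, smul_eq_mul]
    · intro v _ w _ hvw
      exact disjoint_image_shift hm' hvw
  have hcardA : #A = (m - 1) ^ d * D := card_boxPlaqs _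
  have hcard_univ : Fintype.card (QuantumFieldTheory.Plaquette d L) = L ^ d * D := by
    rw [hD, Fintype.card_prod, Fintype.card_fun, ZMod.card, Fintype.card_fin]
  have hcompl : (#Iᶜ : ℝ) = (L : ℝ) ^ d * D - (q : ℝ) ^ d * ((m - 1 : ℕ) : ℝ) ^ d * D := by
    rw [card_compl, Nat.cast_sub (card_le_univ I), hcard_univ, hcardI, hcardA]
    push_cast
    ring
  -- the integrals
  set T : ℝ := ∫ U, ∏ p ∈ univ, 𝔱⟦β, p, U⟧ ∂P with hT
  set z : ℝ := ℨ⟦β, A⟧ with hz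
  have hz0 : 0 < z := zdZ_pos ρ hρ β A
  have hZI : ∫ U, ∏ p ∈ I, 𝔱⟦β, p, U⟧ ∂P = z ^ (q ^ d) := by
    rw [hI, hP, integral_torusWeight_image ρ hρ β hI'b, hI', zdZ_biUnion_translate ρ hρ β hm' V,
      hV, card_halfOpenBox]
  have hup : T ≤ Real.exp K ^ #Iᶜ * z ^ (q ^ d) := by
    rw [← hZI, ← integral_const_mul]
    exact integral_mono (integrable_torusWeight ρ hρ β _)
      ((integrable_torusWeight ρ hρ β I).const_mul _) fun U => torusWeight_univ_le ρ hM β I U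
  have hlow : Real.exp (-K) ^ #Iᶜ * z ^ (q ^ d) ≤ T := by
    rw [← hZI, ← integral_const_mul]
    exact integral_mono ((integrable_torusWeight ρ hρ β I).const_mul _)
      (integrable_torusWeight ρ hρ β _) fun U => mul_torusWeight_le_univ ρ hM β I U
  have hT0 : 0 < T := lt_of_lt_of_le (by positivity) hlow
  -- logarithms
  have hlogZ : torusLogPartition d ρ β L = Real.log T := by
    rw [torusLogPartition, partitionFunction_eq_ofReal_integral ρ hρ β,
      ENNReal.toReal_ofReal hT0.le]
  have h1 : Real.log T ≤ #Iᶜ * K + (q ^ d : ℕ) * Real.log z := by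
    have := Real.log_le_log hT0 hup
    rwa [Real.log_mul (by positivity) (by positivity), Real.log_pow, Real.log_exp,
      Real.log_pow] at this
  have h2 : #Iᶜ * (-K) + (q ^ d : ℕ) * Real.log z ≤ Real.log T := by
    have := Real.log_le_log (by positivity) hlow
    rwa [Real.log_mul (by positivity) (by positivity), Real.log_pow, Real.log_exp,
      Real.log_pow] at this
  rw [hlogZ, abs_le]
  have hKD : (#Iᶜ : ℝ) * K = K * (D * ((L : ℝ) ^ d - (q ^ d : ℕ) * ((m - 1 : ℕ) : ℝ) ^ d)) := by
    rw [hcompl]; push_cast; ring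
  constructor <;> nlinarith [hKD, h1, h2]

omit [Group G] [TopologicalSpace G] [IsTopologicalGroup G] [CompactSpace G] [MeasurableSpace G]
  [BorelSpace G] [SecondCountableTopology G] in
/-- An abstract convergence criterion: a real sequence `b` which, for all large `m`, is
eventually within `δ_m + ε` of a constant `c_m`, with `δ_m → 0`, is Cauchy, hence converges.
[folklore] -/
theorem exists_tendsto_of_eventually_abs_sub_le {b c δ : ℕ → ℝ} (hδ : Tendsto δ atTop (𝓝 0))
    (h : ∀ᶠ m in atTop, ∀ ε > 0, ∀ᶠ L in atTop, |b L - c m| ≤ δ m + ε) :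
    ∃ f, Tendsto b atTop (𝓝 f) := by
  refine cauchySeq_tendsto_of_complete (Metric.cauchySeq_iff.2 fun ε hε => ?_)
  have hδ' : ∀ᶠ m in atTop, δ m < ε / 4 := hδ.eventually (gt_mem_nhds (by linarith))
  obtain ⟨m, hm1, hm2⟩ := (h.and hδ').exists
  obtain ⟨N₀, hN₀⟩ := eventually_atTop.1 (hm1 (ε / 4) (by linarith))
  refine ⟨N₀, fun L hL L' hL' => ?_⟩
  have e1 := hN₀ L hL
  have e2 := hN₀ L' hL'
  rw [Real.dist_eq]
  calc |b L - b L'| = |(b L - c m) - (b L' - c m)| := by ring_nf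
    _ ≤ |b L - c m| + |b L' - c m| := abs_sub _ _
    _ < ε := by linarith

omit [Group G] [TopologicalSpace G] [IsTopologicalGroup G] [CompactSpace G] [MeasurableSpace G]
  [BorelSpace G] [SecondCountableTopology G] in
/-- `⌊L'/m⌋ / L' → 1/m` along the torus sizes `L' = L + 1`. [folklore] -/
theorem tendsto_div_floor (m : ℕ) :
    Tendsto (fun L : ℕ => (((L + 1) / m : ℕ) : ℝ) / ((L + 1 : ℕ) : ℝ)) atTop (𝓝 (1 / m)) := by
  have h1 : Tendsto (fun L : ℕ => ((L + 1 : ℕ) : ℝ)) atTop atTop :=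
    tendsto_natCast_atTop_atTop.comp (tendsto_add_atTop_nat 1)
  have h2 := (tendsto_nat_floor_mul_div_atTop (a := (1 / m : ℝ)) (by positivity)).comp h1
  refine h2.congr fun L => ?_
  simp only [Function.comp_apply]
  rw [one_div_mul_eq_div, Nat.floor_div_eq_div]

/-- **The free energy density of the torus Wilson theory exists** (the limit statement behind
`exists_hasFreeEnergyDensity_holds`): `(L+1)^{-d} log Z_{Λ_{L+1}, β}` converges as `L → ∞`, by the
sub-box estimate `abs_torusLogPartition_sub_le` and the Cauchy criterion
`exists_tendsto_of_eventually_abs_sub_le`. [cite: FriedliVelenik2017, Ch. 3 §3.2.2, Thm. 3.6] -/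
theorem exists_tendsto_torusLogPartition (hρ : Continuous ρ) (β : ℝ) :
    ∃ f, Tendsto (fun L : ℕ => (((L + 1 : ℕ) : ℝ) ^ d)⁻¹ * torusLogPartition d ρ β (L + 1))
      atTop (𝓝 f) := by
  obtain ⟨M, -, hM⟩ := QuantumFieldTheory.exists_bound_trace_re_nonneg ρ hρ
  set D : ℕ := Fintype.card {q : Fin d × Fin d // q.1 < q.2} with hD
  set K : ℝ := |β| * (N + M) with hK
  -- the comparison constants `c_m = m^{-d} log Z(A_m)` and the defects `δ_m`
  set c : ℕ → ℝ := fun m => ((m : ℝ) ^ d)⁻¹ * Real.log ℨ⟦β, 𝔅⟦m - 1⟧⟧ with hc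
  set δ : ℕ → ℝ := fun m => K * D * (1 - (1 / (m : ℝ)) ^ d * ((m - 1 : ℕ) : ℝ) ^ d) with hδ
  refine exists_tendsto_of_eventually_abs_sub_le (c := c) (δ := δ) ?_ ?_
  · -- `δ_m → 0`
    have h1 : Tendsto (fun m : ℕ => (1 / (m : ℝ)) * ((m - 1 : ℕ) : ℝ)) atTop (𝓝 1) := by
      have h : Tendsto (fun m : ℕ => (1 : ℝ) - 1 / (m : ℝ)) atTop (𝓝 (1 - 0)) :=
        tendsto_const_nhds.sub tendsto_one_div_atTop_nhds_zero_nat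
      rw [sub_zero] at h
      refine h.congr' ?_
      filter_upwards [eventually_ge_atTop 1] with m hm
      have hm0 : (m : ℝ) ≠ 0 := by exact_mod_cast (Nat.one_le_iff_ne_zero.1 hm)
      rw [Nat.cast_sub hm, Nat.cast_one]
      field_simp
    have h2 : Tendsto (fun m : ℕ => K * D * (1 - ((1 / (m : ℝ)) * ((m - 1 : ℕ) : ℝ)) ^ d))
        atTop (𝓝 (K * D * (1 - 1 ^ d))) :=
      (tendsto_const_nhds.sub (h1.pow d)).const_mul _
    rw [one_pow, sub_self, mul_zero] at h2
    refine h2.congr fun m => ?_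
    rw [hδ, mul_pow]
  · -- the sub-box estimate, divided by `(L+1)^d`
    filter_upwards [eventually_ge_atTop 1] with m hm ε hε
    set z : ℝ := ℨ⟦β, 𝔅⟦m - 1⟧⟧ with hz
    set mm : ℝ := ((m - 1 : ℕ) : ℝ) ^ d with hmm
    set r : ℕ → ℝ := fun L => (((L + 1) / m : ℕ) : ℝ) / ((L + 1 : ℕ) : ℝ) with hr
    have hrt : Tendsto r atTop (𝓝 (1 / m)) := tendsto_div_floor m
    have hR : Tendsto
        (fun L => K * D * (1 - r L ^ d * mm) + |Real.log z| * |r L ^ d - (1 / (m : ℝ)) ^ d|)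
        atTop (𝓝 (K * D * (1 - (1 / (m : ℝ)) ^ d * mm) +
          |Real.log z| * |(1 / (m : ℝ)) ^ d - (1 / (m : ℝ)) ^ d|)) :=
      ((tendsto_const_nhds.sub ((hrt.pow d).mul_const mm)).const_mul _).add
        (((hrt.pow d).sub_const _).abs.const_mul _)
    rw [sub_self, abs_zero, mul_zero, add_zero] at hR
    have hev : ∀ᶠ L : ℕ in atTop,
        K * D * (1 - r L ^ d * mm) + |Real.log z| * |r L ^ d - (1 / (m : ℝ)) ^ d| < δ m + ε :=
      hR.eventually (Iio_mem_nhds (by rw [hδ]; linarith))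
    filter_upwards [hev] with L hL
    -- pointwise: `|b_L - c_m| ≤ K D (1 - r^d mm) + |log z| |r^d - m^{-d}|`
    have hE := abs_torusLogPartition_sub_le (d := d) ρ hρ hM β (L + 1) m hm
    set s : ℝ := ((L + 1 : ℕ) : ℝ) ^ d with hs
    have hs0 : 0 < s := by positivity
    set X : ℝ := torusLogPartition d ρ β (L + 1) with hX
    set qd : ℝ := ((((L + 1) / m) ^ d : ℕ) : ℝ) with hqd
    have hrd : r L ^ d = s⁻¹ * qd := by
      rw [hr, hqd, hs]
      simp only
      rw [div_pow, Nat.cast_pow]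
      ring
    have hb : s⁻¹ * X - r L ^ d * Real.log z = s⁻¹ * (X - qd * Real.log z) := by
      rw [hrd]; ring
    have hstep1 : |s⁻¹ * X - r L ^ d * Real.log z| ≤ K * D * (1 - r L ^ d * mm) := by
      rw [hb, abs_mul, abs_of_pos (inv_pos.2 hs0)]
      calc s⁻¹ * |X - qd * Real.log z| ≤ s⁻¹ * (K * (D * (s - qd * mm))) :=
            mul_le_mul_of_nonneg_left hE (inv_pos.2 hs0).le
        _ = K * D * (1 - r L ^ d * mm) := by
            rw [hrd]
            field_simp
    have hstep2 :
        |r L ^ d * Real.log z - c m| = |Real.log z| * |r L ^ d - (1 / (m : ℝ)) ^ d| := by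
      rw [hc]
      simp only
      rw [← abs_mul, one_div, inv_pow]
      congr 1
      ring
    calc |s⁻¹ * X - c m| ≤ |s⁻¹ * X - r L ^ d * Real.log z| + |r L ^ d * Real.log z - c m| :=
          abs_sub_le _ _ _
      _ ≤ K * D * (1 - r L ^ d * mm) + |Real.log z| * |r L ^ d - (1 / (m : ℝ)) ^ d| := by
          rw [hstep2]; exact add_le_add hstep1 le_rfl
      _ ≤ δ m + ε := hL.le

end FreeEnergy

variable {d N : ℕ} {G : Type*} [Group G] [TopologicalSpace G] [IsTopologicalGroup G]
  [CompactSpace G] [MeasurableSpace G] [BorelSpace G] (ρ : G →* Matrix (Fin N) (Fin N) ℂ)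

/-- **Existence of the free energy density of lattice gauge theory on tori** — discharge of the
named fact `exists_hasFreeEnergyDensity`: for a continuous matrix representation `ρ` of the
compact (second countable) gauge group `G` and every `β ∈ ℝ`, the limit
`f(β) = lim_{L → ∞} |Λ_L|⁻¹ log Z_{Λ_L, β}` along the tori `Λ_L = (ℤ/Lℤ)^d` exists.

The source cited by the statement (Chatterjee, J. Funct. Anal. 271 (2016), arXiv:1602.01222)
defines the free energy per site `F(Λ, g₀) = log Z(Λ, g₀)/|Λ|` (§2, "Results") and determines its
leading term as `g₀ → 0` on cubes with free boundary condition (Thm. 2.1 of the arXiv version,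
called Thm. 1.1 in the docstring of the statement); the existence of the thermodynamic limit at
fixed coupling, for an arbitrary bounded finite-range (here: plaquette) interaction and
periodic boundary condition, is the standard van Hove argument, whose printed form followed
here is Friedli–Velenik 2017, Thm. 3.6 (decomposition into translates of a fixed cube, boundary
error `O(surface)`, comparison of periodic and free boundary conditions). The proof:
`FreeEnergy.abs_torusLogPartition_sub_le` (the sub-box estimate on the torus, via factorisation
of the product Haar measure over edge-disjoint cubes, translation invariance, and periodisation
`QuantumFieldTheory.integral_torusLift_eq_integral_zdHaar`) and the Cauchy criterion
`FreeEnergy.exists_tendsto_of_eventually_abs_sub_le`; no hypothesis on `d`, `N`, `β` or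
unitarity of `ρ` is needed (for `d ≤ 1` there are no plaquettes and the sequence is
identically `0`).
[cite: FriedliVelenik2017, Ch. 3 §3.2.2, Thm. 3.6 (existence of the pressure, any boundary condition)] -/
theorem exists_hasFreeEnergyDensity_holds : exists_hasFreeEnergyDensity (d := d) ρ :=
  fun hρ β => FreeEnergy.exists_tendsto_torusLogPartition ρ hρ β

end Literature.MathematicalPhysics.QuantumLattice
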